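import Mathlib
import Summits.AtomisticToContinuum.HydrodynamicLimit.Theorems.RelayRaceLocalityNearConstantShortTimeHLAssemblyTheta
import Summits.AtomisticToContinuum.HydrodynamicLimit.Theorems.RelayRaceLocalityNearConstantShortTimeHLSolutionTests
import Summits.AtomisticToContinuum.HydrodynamicLimit.Theorems.RelayRaceLocalityNearConstantShortTimeHLEntropyFluxRemainderA
import Summits.AtomisticToContinuum.HydrodynamicLimit.Theorems.PolynomialCompression.Negative.EntropyHardSphere
import Literature.MathematicalPhysics.KineticTheory.HardSphereEulerSolutionGluing
import Literature.MathematicalPhysics.KineticTheory.HardSphereEulerPrimitiveForm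
import Literature.Analysis.FunctionSpaces.TorusSpaceTime
import HarnessLib

/-!
# Crux `NearConstantShortTimeHL` (stmt-AtomisticToContinuum-12502), line `small-tilt-domination`:
# stubs `eulerRate_eq`, `integral_logProfileStatic_sub_eq` — the Euler side of the relative-entropy Grönwall

Lead c3, wave 2. The STATIC mean `m^{st}(r) = ∫ ρ_r (log ρ_r + g_σ(ρ_r) − 3/2 log(2πθ_r) − 3/2) dx` of the
log-profile of the Euler-matched local Gibbs law evolves by the entropy-rate density `Θ` at the Euler state:
`m^{st}(b) − m^{st}(a) = ∫_a^b ∫_𝕋³ Θ_r(x)(U^E_r(x)) dx dr`. Route: pointwise `ρ(log ρ + g − 3/2 log 2πθ − 3/2)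
= λ⁰ρ + Σⱼ λⱼ(ρuⱼ) + λ⁴E` (`wa_static_eq_pairing`); the pairing `λ·U^E` is jointly smooth on a slab `[0, T')`,
`t < T' ≤ T`, on which the packing band persists (`exists_horizon_of_packing_lt`,
`isSmoothSpaceTimeOn_logProfileRows`, `hs_isSmoothSpaceTimeOn_pressure`), so `m^{st}` may be differentiated
under `∫_𝕋³` (`Torus.IsSmoothSpaceTimeOn.hasDerivWithinAt_integral`); the Leibniz rules and the three
conservation laws give the pointwise balance `Θ(U^E) = ∂ₜ(λ·U^E) + Σₖ ∂ₖΨₖ` with an explicit flux `Ψ`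
(`wa_eulerRate_eq_timeDerivWithin_add`), whose divergence integrates to zero on the torus; finally the
fundamental theorem of calculus on `[a, b] ⊆ [0, t]`. `eulerRate_eq` is the bookkeeping identity writing
`Θ_r(x)(U^E_r(x))` out (`stateTemp_euler`). Helper prefix `wa_`. No definitions, no named facts.

References: H.-T. Yau, Lett. Math. Phys. 22 (1991) 63–80, §2; C. M. Dafermos, Arch. Rational Mech. Anal. 70
(1979) 167–179.
-/

noncomputable section

namespace Summit.AtomisticToContinuum.HydrodynamicLimit.Theorems.NearConstantShortTimeHL

open scoped BigOperators ENNReal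
open MeasureTheory Set Filter
open Literature.MathematicalPhysics.KineticTheory Literature.Analysis.FluidPDE Literature.Analysis.FunctionSpaces

/-- **The entropy-rate density at the Euler state, written out** (registered stub `eulerRate_eq`): for
`ρ_r(x) ≠ 0`, `Θ_r(x)(U^E_r(x)) = ∂ₜλ⁰ ρ + Σⱼ ∂ₜλⱼ (ρuⱼ) + ∂ₜλ⁴ E + Σₖ ∂ₖλ⁰ (ρuₖ) +
Σₖ Σⱼ ∂ₖλⱼ (ρuₖuⱼ + δₖⱼ p) + Σₖ ∂ₖλ⁴ ((E + p)uₖ)` with `p = hsPressure σ ρ θ`, `E = totalEnergyDensity ρ u θ`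
(the state temperature of `U^E` is `θ`, `stateTemp_euler`, and `m'ₖm'ⱼ/ρ' = ρuₖuⱼ`, `(E+p)m'ₖ/ρ' = (E+p)uₖ`).
[cite: Yau1991, §2] -/
theorem eulerRate_eq : ∀ {σ T : ℝ} {ρ θ : ℝ → T3 → ℝ} {u : ℝ → T3 → V3} {r : ℝ} {x : T3}, ρ r x ≠ 0 → eulerRate σ T ρ θ u r x = Torus.timeDerivWithin (Set.Ico 0 T) (lam0Row σ ρ θ u) r x * ρ r x + (∑ j, Torus.timeDerivWithin (Set.Ico 0 T) (lamRow θ u) r x j * (ρ r x * u r x j)) + Torus.timeDerivWithin (Set.Ico 0 T) (lam4Row θ) r x * totalEnergyDensity (ρ r x) (u r x) (θ r x) + (∑ k, Torus.partialDeriv k (lam0Row σ ρ θ u r) x * (ρ r x * u r x k)) + (∑ k, ∑ j, Torus.partialDeriv k (lamRow θ u r) x j * (ρ r x * u r x k * u r x j + if k = j then hsPressure σ (ρ r x) (θ r x) else 0)) + ∑ k, Torus.partialDeriv k (lam4Row θ r) x * ((totalEnergyDensity (ρ r x) (u r x) (θ r x) + hsPressure σ (ρ r x) (θ r x)) * u r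 x k) := by
  intro σ T ρ θ u r x hρ
  have hT : stateTemp (ρ r x) (totalEnergyDensity (ρ r x) (u r x) (θ r x)) (ρ r x • u r x) = θ r x :=
    stateTemp_euler (u r x) hρ
  have hsm : ∀ k, (ρ r x • u r x) k = ρ r x * u r x k := fun k => by simp [PiLp.smul_apply, smul_eq_mul]
  unfold eulerRate entropyRate
  simp only [hT, hsm]
  have h1 : ∀ k j, ρ r x * u r x k * (ρ r x * u r x j) / ρ r x = ρ r x * u r x k * u r x j :=
    fun k j => by field_simp
  have h2 : ∀ k, (totalEnergyDensity (ρ r x) (u r x) (θ r x) + hsPressure σ (ρ r x) (θ r x)) *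
      (ρ r x * u r x k) / ρ r x =
      (totalEnergyDensity (ρ r x) (u r x) (θ r x) + hsPressure σ (ρ r x) (θ r x)) * u r x k :=
    fun k => by field_simp
  simp only [h1, h2]

/-- Pointwise, the static log-profile integrand is the pairing of the rows with the Euler state:
`ρ (log ρ + g_σ(ρ) − 3/2 log(2πθ) − 3/2) = λ⁰ ρ + Σⱼ λⱼ (ρ uⱼ) + λ⁴ E` (for `θ ≠ 0`). [folklore] -/
theorem wa_static_eq_pairing {σ : ℝ} {ρ θ : ℝ → T3 → ℝ} {u : ℝ → T3 → V3} {s : ℝ} {y : T3}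
    (hθ : θ s y ≠ 0) :
    ρ s y * (Real.log (ρ s y) + gChem σ (ρ s y) - 3 / 2 * Real.log (2 * Real.pi * θ s y) - 3 / 2) =
      lam0Row σ ρ θ u s y * ρ s y + (∑ j, lamRow θ u s y j * (ρ s y * u s y j)) +
        lam4Row θ s y * totalEnergyDensity (ρ s y) (u s y) (θ s y) := by
  have hsm : ∀ j, lamRow θ u s y j = (θ s y)⁻¹ * u s y j := fun j => rfl
  simp only [hsm]
  unfold lam0Row lam4Row totalEnergyDensity
  rw [EuclideanSpace.real_norm_sq_eq]
  simp only [Fin.sum_univ_three]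
  field_simp
  ring

/-- Leibniz rule for the one-sided time derivative of a pairing `A⁰R + Σⱼ AⱼMⱼ + A⁴E` of jointly smooth
scalar space–time fields (on a time set of unique differentiability). [folklore] -/
theorem wa_timeDerivWithin_pairing {S : Set ℝ} (hS : UniqueDiffOn ℝ S) {A0 A4 R E : ℝ → T3 → ℝ}
    {A M : Fin 3 → ℝ → T3 → ℝ} (hA0 : Torus.IsSmoothSpaceTimeOn S A0)
    (hA4 : Torus.IsSmoothSpaceTimeOn S A4) (hR : Torus.IsSmoothSpaceTimeOn S R)
    (hE : Torus.IsSmoothSpaceTimeOn S E) (hA : ∀ j, Torus.IsSmoothSpaceTimeOn S (A j))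
    (hM : ∀ j, Torus.IsSmoothSpaceTimeOn S (M j)) {r : ℝ} (hr : r ∈ S) (x : T3) :
    Torus.timeDerivWithin S
        (fun s y => A0 s y * R s y + (∑ j, A j s y * M j s y) + A4 s y * E s y) r x =
      Torus.timeDerivWithin S A0 r x * R r x + A0 r x * Torus.timeDerivWithin S R r x +
        (∑ j, (Torus.timeDerivWithin S (A j) r x * M j r x +
          A j r x * Torus.timeDerivWithin S (M j) r x)) +
        (Torus.timeDerivWithin S A4 r x * E r x + A4 r x * Torus.timeDerivWithin S E r x) := by
  have h0 := hA0.hasDerivWithinAt_slice hr x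
  have h4 := hA4.hasDerivWithinAt_slice hr x
  have hR' := hR.hasDerivWithinAt_slice hr x
  have hE' := hE.hasDerivWithinAt_slice hr x
  have hA' := fun j => (hA j).hasDerivWithinAt_slice hr x
  have hM' := fun j => (hM j).hasDerivWithinAt_slice hr x
  exact (((h0.fun_mul hR').fun_add (HasDerivWithinAt.fun_sum (u := Finset.univ)
    (A := fun j τ => A j τ x * M j τ x)
    (A' := fun j => Torus.timeDerivWithin S (A j) r x * M j r x +
      A j r x * Torus.timeDerivWithin S (M j) r x)
    fun j _ => (hA' j).fun_mul (hM' j))).fun_add (h4.fun_mul hE')).derivWithin (hS r hr)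

/-- Leibniz rule along the `k`-th coordinate line for the flux component `a⁰m + Σⱼ aⱼFⱼ + qP + a⁴H` built
from `C¹` functions on `𝕋³`. [folklore] -/
theorem wa_partialDeriv_flux {a0 a4 q P m H : T3 → ℝ} {a Fl : Fin 3 → T3 → ℝ}
    (ha0 : Torus.IsContDiff 1 a0) (ha4 : Torus.IsContDiff 1 a4) (hq : Torus.IsContDiff 1 q)
    (hP : Torus.IsContDiff 1 P) (hm : Torus.IsContDiff 1 m) (hH : Torus.IsContDiff 1 H)
    (ha : ∀ j, Torus.IsContDiff 1 (a j)) (hFl : ∀ j, Torus.IsContDiff 1 (Fl j)) (k : Fin 3)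
    (x : T3) :
    Torus.partialDeriv k (fun y => a0 y * m y + (∑ j, a j y * Fl j y) + q y * P y + a4 y * H y) x =
      Torus.partialDeriv k a0 x * m x + a0 x * Torus.partialDeriv k m x +
        (∑ j, (Torus.partialDeriv k (a j) x * Fl j x + a j x * Torus.partialDeriv k (Fl j) x)) +
        (Torus.partialDeriv k q x * P x + q x * Torus.partialDeriv k P x) +
        (Torus.partialDeriv k a4 x * H x + a4 x * Torus.partialDeriv k H x) := by
  have c0 := HsEulerCalc.hasDerivAt_coordLine ha0 x k
  have c4 := HsEulerCalc.hasDerivAt_coordLine ha4 x k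
  have cq := HsEulerCalc.hasDerivAt_coordLine hq x k
  have cP := HsEulerCalc.hasDerivAt_coordLine hP x k
  have cm := HsEulerCalc.hasDerivAt_coordLine hm x k
  have cH := HsEulerCalc.hasDerivAt_coordLine hH x k
  have ca := fun j => HsEulerCalc.hasDerivAt_coordLine (ha j) x k
  have cF := fun j => HsEulerCalc.hasDerivAt_coordLine (hFl j) x k
  have h := (((c0.fun_mul cm).fun_add (HasDerivAt.fun_sum (u := Finset.univ)
    (A := fun j s => a j (x + Torus.proj (s • EuclideanSpace.single k (1 : ℝ))) *
      Fl j (x + Torus.proj (s • EuclideanSpace.single k (1 : ℝ))))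
    (A' := fun j => Torus.partialDeriv k (a j) x *
        Fl j (x + Torus.proj ((0 : ℝ) • EuclideanSpace.single k (1 : ℝ))) +
      a j (x + Torus.proj ((0 : ℝ) • EuclideanSpace.single k (1 : ℝ))) * Torus.partialDeriv k (Fl j) x)
    fun j _ => (ca j).fun_mul (cF j))).fun_add (cq.fun_mul cP)).fun_add (c4.fun_mul cH)
  refine HsEulerCalc.partialDeriv_eq_of_hasDerivAt (h.congr_deriv ?_)
  simp only [zero_smul, Torus.proj_zero, add_zero]

/-- **Pointwise entropy balance at the Euler state.** Along a classical solution on `[0, T)` whose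
log-profile rows and pressure are jointly smooth, `Θ_r(x)(U^E) = ∂ₜ(λ·U^E)(r, x) + Σₖ ∂ₖΨₖ(r, x)` with
the flux `Ψₖ = λ⁰ ρuₖ + Σⱼ λⱼ ρuₖuⱼ + λₖ p + λ⁴ (E + p)uₖ`: the Leibniz rules plus the three
conservation laws `∂ₜρ = −div(ρu)`, `∂ₜ(ρu)ⱼ = −Σₖ∂ₖ(ρuₖuⱼ) − ∂ⱼp`, `∂ₜE = −div((E+p)u)`.
[cite: Yau1991, §2] -/
theorem wa_eulerRate_eq_timeDerivWithin_add {σ T : ℝ} {ρ θ : ℝ → T3 → ℝ} {u : ℝ → T3 → V3}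
    (hE : IsHardSphereEulerSolution σ T ρ u θ)
    (hL0 : Torus.IsSmoothSpaceTimeOn (Set.Ico 0 T) (lam0Row σ ρ θ u))
    (hL : Torus.IsSmoothSpaceTimeOn (Set.Ico 0 T) (lamRow θ u))
    (hL4 : Torus.IsSmoothSpaceTimeOn (Set.Ico 0 T) (lam4Row θ))
    (hP : Torus.IsSmoothSpaceTimeOn (Set.Ico 0 T) (fun s y => hsPressure σ (ρ s y) (θ s y)))
    {r : ℝ} (hr : r ∈ Set.Ico 0 T) (x : T3) :
    eulerRate σ T ρ θ u r x =
      Torus.timeDerivWithin (Set.Ico 0 T) (fun s y => lam0Row σ ρ θ u s y * ρ s y +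
        (∑ j, lamRow θ u s y j * (ρ s y * u s y j)) +
        lam4Row θ s y * totalEnergyDensity (ρ s y) (u s y) (θ s y)) r x +
      ∑ k, Torus.partialDeriv k (fun y => lam0Row σ ρ θ u r y * (ρ r y * u r y k) +
        (∑ j, lamRow θ u r y j * (ρ r y * u r y k * u r y j)) +
        lamRow θ u r y k * hsPressure σ (ρ r y) (θ r y) +
        lam4Row θ r y * ((totalEnergyDensity (ρ r y) (u r y) (θ r y) + hsPressure σ (ρ r y) (θ r y)) *
          u r y k)) x := by
  have hU : UniqueDiffOn ℝ (Set.Ico (0 : ℝ) T) := uniqueDiffOn_Ico 0 T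
  have hρ := hE.smooth_density
  have hu := hE.smooth_velocity
  have hθ := hE.smooth_temperature
  have hEn : Torus.IsSmoothSpaceTimeOn (Set.Ico 0 T)
      (fun s y => totalEnergyDensity (ρ s y) (u s y) (θ s y)) := by
    unfold totalEnergyDensity
    exact hρ.mul (((hu.norm_sq ℝ).div_const 2).add (contDiffOn_const.mul hθ))
  -- the time derivative of the pairing
  have hD := wa_timeDerivWithin_pairing hU (A := fun j s y => lamRow θ u s y j)
    (M := fun j s y => ρ s y * u s y j) hL0 hL4 hρ hEn (fun j => hL.apply j)
    (fun j => hρ.mul (hu.apply j)) hr x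
  have hAj : ∀ j, Torus.timeDerivWithin (Set.Ico 0 T) (fun s y => lamRow θ u s y j) r x =
      Torus.timeDerivWithin (Set.Ico 0 T) (lamRow θ u) r x j := fun j =>
    HsEulerCalc.timeDerivWithin_apply_coord hL hU hr x j
  have hMj : ∀ j, Torus.timeDerivWithin (Set.Ico 0 T) (fun s y => ρ s y * u s y j) r x =
      Torus.timeDerivWithin (Set.Ico 0 T) (fun s y => ρ s y • u s y) r x j := fun j =>
    HsEulerCalc.timeDerivWithin_apply_coord (hρ.smul hu) hU hr x j
  -- `C¹` slices at time `r`
  have s0 : Torus.IsContDiff 1 (lam0Row σ ρ θ u r) := (hL0.isSmooth_slice hr).isContDiff (by simp)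
  have sL : Torus.IsContDiff 1 (lamRow θ u r) := (hL.isSmooth_slice hr).isContDiff (by simp)
  have sLj : ∀ j, Torus.IsContDiff 1 (fun y => lamRow θ u r y j) := fun j =>
    HsEulerCalc.isContDiff_apply_coord sL j
  have s4 : Torus.IsContDiff 1 (lam4Row θ r) := (hL4.isSmooth_slice hr).isContDiff (by simp)
  have sρ : Torus.IsContDiff 1 (ρ r) := (hρ.isSmooth_slice hr).isContDiff (by simp)
  have su : Torus.IsContDiff 1 (u r) := (hu.isSmooth_slice hr).isContDiff (by simp)
  have suj : ∀ j, Torus.IsContDiff 1 (fun y => u r y j) := fun j =>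
    HsEulerCalc.isContDiff_apply_coord su j
  have sP : Torus.IsContDiff 1 (fun y => hsPressure σ (ρ r y) (θ r y)) :=
    (hP.isSmooth_slice hr).isContDiff (by simp)
  have sEn : Torus.IsContDiff 1 (fun y => totalEnergyDensity (ρ r y) (u r y) (θ r y)) :=
    (hEn.isSmooth_slice hr).isContDiff (by simp)
  have sm : ∀ k, Torus.IsContDiff 1 (fun y => ρ r y * u r y k) := fun k => sρ.mul (suj k)
  have sF : ∀ k j, Torus.IsContDiff 1 (fun y => ρ r y * u r y k * u r y j) := fun k j =>
    (sρ.mul (suj k)).mul (suj j)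
  have sH : ∀ k, Torus.IsContDiff 1 (fun y => (totalEnergyDensity (ρ r y) (u r y) (θ r y) +
      hsPressure σ (ρ r y) (θ r y)) * u r y k) := fun k => (sEn.add sP).mul (suj k)
  have sMF : ∀ k, Torus.IsContDiff 1 (fun y => (ρ r y * u r y k) • u r y) := fun k =>
    ((sρ.mul (suj k)).smul su :)
  -- the flux derivatives
  have hΦ := fun k => wa_partialDeriv_flux s0 s4 (sLj k) sP (sm k) (sH k) sLj (sF k) k x
  -- the conservation laws in coordinates
  have hCρ : Torus.timeDerivWithin (Set.Ico 0 T) ρ r x +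
      ∑ k, Torus.partialDeriv k (fun y => ρ r y * u r y k) x = 0 := by
    simpa only [Torus.divergence, PiLp.smul_apply, smul_eq_mul] using hE.mass r hr x
  have hCE : Torus.timeDerivWithin (Set.Ico 0 T)
      (fun s y => totalEnergyDensity (ρ s y) (u s y) (θ s y)) r x +
      ∑ k, Torus.partialDeriv k (fun y => (totalEnergyDensity (ρ r y) (u r y) (θ r y) +
        hsPressure σ (ρ r y) (θ r y)) * u r y k) x = 0 := by
    simpa only [Torus.divergence, PiLp.smul_apply, smul_eq_mul] using hE.energy r hr x
  have hCm : ∀ j, Torus.timeDerivWithin (Set.Ico 0 T) (fun s y => ρ s y • u s y) r x j +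
      ∑ k, Torus.partialDeriv k (fun y => ρ r y * u r y k * u r y j) x +
      Torus.partialDeriv j (fun y => hsPressure σ (ρ r y) (θ r y)) x = 0 := by
    intro j
    have h := congrArg (fun v : V3 => v j) (hE.momentum r hr x)
    have hsum : (∑ i, Torus.partialDeriv i (fun y => (ρ r y * u r y i) • u r y) x) j =
        ∑ i, Torus.partialDeriv i (fun y => ρ r y * u r y i * u r y j) x := by
      rw [show (∑ i, Torus.partialDeriv i (fun y => (ρ r y * u r y i) • u r y) x) j =
        ∑ i, Torus.partialDeriv i (fun y => (ρ r y * u r y i) • u r y) x j by simp]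
      refine Finset.sum_congr rfl fun i _ => ?_
      rw [← Torus.partialDeriv_apply_coord (sMF i) i x j]
      rfl
    have hgrad : Torus.gradient (fun y => hsPressure σ (ρ r y) (θ r y)) x j =
        Torus.partialDeriv j (fun y => hsPressure σ (ρ r y) (θ r y)) x :=
      HsEulerCalc.gradient_apply_eq_partialDeriv sP x j
    simp only [PiLp.add_apply, PiLp.zero_apply] at h
    rwa [hsum, hgrad] at h
  -- assemble
  rw [eulerRate_eq (hE.density_pos r hr x).ne', hD]
  simp only [hΦ, hAj, hMj, Torus.partialDeriv_apply_coord sL]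
  simp only [mul_add, mul_ite, mul_zero, Finset.sum_add_distrib, Finset.sum_ite_eq, Finset.mem_univ,
    if_true]
  have hCm0 := hCm 0
  have hCm1 := hCm 1
  have hCm2 := hCm 2
  simp only [Fin.sum_univ_three] at hCρ hCE hCm0 hCm1 hCm2 ⊢
  linear_combination -(lam0Row σ ρ θ u r x) * hCρ - lamRow θ u r x 0 * hCm0 - lamRow θ u r x 1 * hCm1 -
    lamRow θ u r x 2 * hCm2 - lam4Row θ r x * hCE

/-- **The Euler-side rate, integrated.** Along a classical solution on `[0, T)` whose log-profile
rows and pressure are jointly smooth, `∫_𝕋³ ∂ₜ(λ·U^E)(r, x) dx = ∫_𝕋³ Θ_r(x)(U^E_r(x)) dx` for every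
`r ∈ [0, T)`: integrate the pointwise balance `wa_eulerRate_eq_timeDerivWithin_add`; the flux
divergence integrates to zero on the torus. [cite: Yau1991, §2] -/
theorem wa_integral_timeDerivWithin_pairing {σ T : ℝ} {ρ θ : ℝ → T3 → ℝ} {u : ℝ → T3 → V3}
    (hE : IsHardSphereEulerSolution σ T ρ u θ)
    (hL0 : Torus.IsSmoothSpaceTimeOn (Set.Ico 0 T) (lam0Row σ ρ θ u))
    (hL : Torus.IsSmoothSpaceTimeOn (Set.Ico 0 T) (lamRow θ u))
    (hL4 : Torus.IsSmoothSpaceTimeOn (Set.Ico 0 T) (lam4Row θ))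
    (hP : Torus.IsSmoothSpaceTimeOn (Set.Ico 0 T) (fun s y => hsPressure σ (ρ s y) (θ s y)))
    {r : ℝ} (hr : r ∈ Set.Ico 0 T) :
    ∫ x, Torus.timeDerivWithin (Set.Ico 0 T) (fun s y => lam0Row σ ρ θ u s y * ρ s y +
        (∑ j, lamRow θ u s y j * (ρ s y * u s y j)) +
        lam4Row θ s y * totalEnergyDensity (ρ s y) (u s y) (θ s y)) r x =
      ∫ x, eulerRate σ T ρ θ u r x := by
  have hU : UniqueDiffOn ℝ (Set.Ico (0 : ℝ) T) := uniqueDiffOn_Ico 0 T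
  have hρ := hE.smooth_density
  have hu := hE.smooth_velocity
  have hθ := hE.smooth_temperature
  have hEn : Torus.IsSmoothSpaceTimeOn (Set.Ico 0 T)
      (fun s y => totalEnergyDensity (ρ s y) (u s y) (θ s y)) := by
    unfold totalEnergyDensity
    exact hρ.mul (((hu.norm_sq ℝ).div_const 2).add (contDiffOn_const.mul hθ))
  have hG : Torus.IsSmoothSpaceTimeOn (Set.Ico 0 T) (fun s y => lam0Row σ ρ θ u s y * ρ s y +
      (∑ j, lamRow θ u s y j * (ρ s y * u s y j)) +
      lam4Row θ s y * totalEnergyDensity (ρ s y) (u s y) (θ s y)) :=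
    ((hL0.mul hρ).add (Torus.IsSmoothSpaceTimeOn.sum
      (w := fun j s y => lamRow θ u s y j * (ρ s y * u s y j))
      fun j _ => (hL.apply j).mul (hρ.mul (hu.apply j)))).add (hL4.mul hEn)
  -- smooth slices at time `r`
  have s0 : Torus.IsSmooth (lam0Row σ ρ θ u r) := hL0.isSmooth_slice hr
  have sLj : ∀ j, Torus.IsSmooth (fun y => lamRow θ u r y j) := fun j =>
    (hL.apply j).isSmooth_slice hr
  have s4 : Torus.IsSmooth (lam4Row θ r) := hL4.isSmooth_slice hr
  have sρ : Torus.IsSmooth (ρ r) := hρ.isSmooth_slice hr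
  have suj : ∀ j, Torus.IsSmooth (fun y => u r y j) := fun j =>
    (hu.apply j).isSmooth_slice hr
  have sP : Torus.IsSmooth (fun y => hsPressure σ (ρ r y) (θ r y)) := hP.isSmooth_slice hr
  have sEn : Torus.IsSmooth (fun y => totalEnergyDensity (ρ r y) (u r y) (θ r y)) :=
    hEn.isSmooth_slice hr
  have hΦs : ∀ k, Torus.IsSmooth (fun y => lam0Row σ ρ θ u r y * (ρ r y * u r y k) +
      (∑ j, lamRow θ u r y j * (ρ r y * u r y k * u r y j)) +
      lamRow θ u r y k * hsPressure σ (ρ r y) (θ r y) +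
      lam4Row θ r y * ((totalEnergyDensity (ρ r y) (u r y) (θ r y) + hsPressure σ (ρ r y) (θ r y)) *
        u r y k)) := fun k =>
    (ContDiff.add (ContDiff.add (ContDiff.add (ContDiff.mul s0 (ContDiff.mul sρ (suj k)))
      (ContDiff.sum (s := Finset.univ)
        (f := fun j v => Torus.lift (fun y => lamRow θ u r y j) v *
          (Torus.lift (ρ r) v * Torus.lift (fun y => u r y k) v * Torus.lift (fun y => u r y j) v))
        fun j _ => ContDiff.mul (sLj j) (ContDiff.mul (ContDiff.mul sρ (suj k)) (suj j))))
      (ContDiff.mul (sLj k) sP)) (ContDiff.mul s4 (ContDiff.mul (ContDiff.add sEn sP) (suj k))) :)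
  have hI1 : Integrable (Torus.timeDerivWithin (Set.Ico 0 T) (fun s y => lam0Row σ ρ θ u s y * ρ s y +
      (∑ j, lamRow θ u s y j * (ρ s y * u s y j)) +
      lam4Row θ s y * totalEnergyDensity (ρ s y) (u s y) (θ s y)) r) :=
    (hG.isSmooth_timeDerivWithin hU hr).integrable
  have hI2 : ∀ k, Integrable (Torus.partialDeriv k (fun y => lam0Row σ ρ θ u r y * (ρ r y * u r y k) +
      (∑ j, lamRow θ u r y j * (ρ r y * u r y k * u r y j)) +
      lamRow θ u r y k * hsPressure σ (ρ r y) (θ r y) +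
      lam4Row θ r y * ((totalEnergyDensity (ρ r y) (u r y) (θ r y) + hsPressure σ (ρ r y) (θ r y)) *
        u r y k))) := fun k => ((hΦs k).partialDeriv k).integrable
  have hpt := fun x => wa_eulerRate_eq_timeDerivWithin_add hE hL0 hL hL4 hP hr x
  rw [integral_congr_ae (Eventually.of_forall hpt), integral_add hI1 (integrable_finsetSum _ fun k _ => hI2 k),
    integral_finsetSum _ fun k _ => hI2 k,
    Finset.sum_eq_zero fun k _ => Torus.integral_partialDeriv_eq_zero_holds (hΦs k) k, add_zero]

/-- **The Euler side on a slab where the packing band holds everywhere.** Along a classical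
solution on `[0, T)` with `ρσ³ < η₀` on `[0, T) × 𝕋³`, the static log-profile mean
`m^{st}(s) = ∫ ρ_s (log ρ_s + g_σ(ρ_s) − 3/2 log(2πθ_s) − 3/2) dx` has one-sided derivative
`∫ Θ_r(x)(U^E_r(x)) dx` within `[0, T)` at every `r`, and the latter is continuous on `[0, T)`
(`m^{st}(s) = ∫ λ_s·U^E_s`, differentiation under `∫_𝕋³`, `wa_integral_timeDerivWithin_pairing`).
[cite: Yau1991, §2] -/
theorem wa_hasDerivWithinAt_logProfileStatic {η₀ : ℝ} {F : ℝ → ℝ} (hη₀ : 0 < η₀)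
    (hFa : AnalyticOnNhd ℝ F (Set.Ioo (-η₀) η₀)) (hEq : Set.EqOn hsExcessFreeEnergy F (Set.Ico 0 η₀))
    {σ T : ℝ} (hσ : 0 < σ) {ρ θ : ℝ → T3 → ℝ} {u : ℝ → T3 → V3}
    (hE : IsHardSphereEulerSolution σ T ρ u θ) (hband : ∀ s ∈ Set.Ico 0 T, ∀ x, ρ s x * σ ^ 3 < η₀) :
    (∀ r ∈ Set.Ico 0 T, HasDerivWithinAt
      (fun s => ∫ x, ρ s x * (Real.log (ρ s x) + gChem σ (ρ s x) -
        3 / 2 * Real.log (2 * Real.pi * θ s x) - 3 / 2))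
      (∫ x, eulerRate σ T ρ θ u r x) (Set.Ico 0 T) r) ∧
    ContinuousOn (fun r => ∫ x, eulerRate σ T ρ θ u r x) (Set.Ico 0 T) := by
  have hU : UniqueDiffOn ℝ (Set.Ico (0 : ℝ) T) := uniqueDiffOn_Ico 0 T
  obtain ⟨hL0, hL, hL4⟩ := isSmoothSpaceTimeOn_logProfileRows hη₀ hFa hEq hσ hE le_rfl hband
  have hL0' : Torus.IsSmoothSpaceTimeOn (Set.Ico 0 T) (lam0Row σ ρ θ u) := hL0
  have hP : Torus.IsSmoothSpaceTimeOn (Set.Ico 0 T) (fun s y => hsPressure σ (ρ s y) (θ s y)) :=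
    PolynomialCompressionEntropy.hs_isSmoothSpaceTimeOn_pressure hη₀ hFa hEq hσ hE hband
  have hρ := hE.smooth_density
  have hu := hE.smooth_velocity
  have hθ := hE.smooth_temperature
  have hEn : Torus.IsSmoothSpaceTimeOn (Set.Ico 0 T)
      (fun s y => totalEnergyDensity (ρ s y) (u s y) (θ s y)) := by
    unfold totalEnergyDensity
    exact hρ.mul (((hu.norm_sq ℝ).div_const 2).add (contDiffOn_const.mul hθ))
  have hG : Torus.IsSmoothSpaceTimeOn (Set.Ico 0 T) (fun s y => lam0Row σ ρ θ u s y * ρ s y +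
      (∑ j, lamRow θ u s y j * (ρ s y * u s y j)) +
      lam4Row θ s y * totalEnergyDensity (ρ s y) (u s y) (θ s y)) :=
    ((hL0'.mul hρ).add (Torus.IsSmoothSpaceTimeOn.sum
      (w := fun j s y => lamRow θ u s y j * (ρ s y * u s y j))
      fun j _ => (hL.apply j).mul (hρ.mul (hu.apply j)))).add (hL4.mul hEn)
  have key : ∀ r ∈ Set.Ico 0 T, ∫ x, Torus.timeDerivWithin (Set.Ico 0 T)
      (fun s y => lam0Row σ ρ θ u s y * ρ s y + (∑ j, lamRow θ u s y j * (ρ s y * u s y j)) +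
        lam4Row θ s y * totalEnergyDensity (ρ s y) (u s y) (θ s y)) r x =
      ∫ x, eulerRate σ T ρ θ u r x := fun r hr =>
    wa_integral_timeDerivWithin_pairing hE hL0' hL hL4 hP hr
  have hstat : ∀ s ∈ Set.Ico 0 T, (∫ x, ρ s x * (Real.log (ρ s x) + gChem σ (ρ s x) -
      3 / 2 * Real.log (2 * Real.pi * θ s x) - 3 / 2)) =
      ∫ x, (lam0Row σ ρ θ u s x * ρ s x + (∑ j, lamRow θ u s x j * (ρ s x * u s x j)) +
        lam4Row θ s x * totalEnergyDensity (ρ s x) (u s x) (θ s x)) := fun s hs =>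
    integral_congr_ae (Eventually.of_forall fun y =>
      wa_static_eq_pairing (u := u) (hE.temperature_pos s hs y).ne')
  refine ⟨fun r hr => ?_, ?_⟩
  · have h := hG.hasDerivWithinAt_integral (convex_Ico 0 T) hr
    rw [key r hr] at h
    exact h.congr (fun s hs => hstat s hs) (hstat r hr)
  · exact ((hG.timeDerivWithin hU).continuousOn_integral (convex_Ico 0 T)).congr
      fun r hr => (key r hr).symm

/-- For `r < T' ≤ T` the Euler-side rate computed with time derivatives within `[0, T')` agrees with
the one computed within `[0, T)`. [folklore] -/
theorem wa_eulerRate_restrict {σ T T' : ℝ} {ρ θ : ℝ → T3 → ℝ} {u : ℝ → T3 → V3} (hT : T' ≤ T)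
    {r : ℝ} (hr : r ∈ Set.Ico 0 T') (x : T3) :
    eulerRate σ T' ρ θ u r x = eulerRate σ T ρ θ u r x := by
  unfold eulerRate entropyRate
  rw [timeDerivWithin_Ico_eq_of_le hT (lam0Row σ ρ θ u) hr x,
    timeDerivWithin_Ico_eq_of_le hT (lamRow θ u) hr x, timeDerivWithin_Ico_eq_of_le hT (lam4Row θ) hr x]

/-- **The Euler side of the relative-entropy Grönwall** (registered stub
`integral_logProfileStatic_sub_eq`). Along a classical hard-sphere–Euler solution whose packing stays
in the analyticity band on `[0, t] × 𝕋³`, `t < T`, the static mean of the log-profile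
`m^{st}(r) = ∫ ρ_r (log ρ_r + g_σ(ρ_r) − 3/2 log(2πθ_r) − 3/2) dx` evolves by the entropy-rate
density at the Euler state, `m^{st}(b) − m^{st}(a) = ∫_a^b ∫_𝕋³ Θ_r(x)(U^E_r(x)) dx dr` for
`0 ≤ a ≤ b ≤ t`, and `r ↦ ∫ Θ_r(U^E_r)` is continuous on `[0, t]` (extend the band to a slab
`[0, T')`, `t < T' ≤ T`, restrict the solution to it, `wa_hasDerivWithinAt_logProfileStatic`, and
the fundamental theorem of calculus). [cite: Yau1991, §2] -/
theorem integral_logProfileStatic_sub_eq : ∀ {η₀ : ℝ} {F : ℝ → ℝ}, 0 < η₀ → AnalyticOnNhd ℝ F (Set.Ioo (-η₀) η₀) → Set.EqOn hsExcessFreeEnergy F (Set.Ico 0 η₀) → ∀ {σ T : ℝ}, 0 < σ → ∀ {ρ θ : ℝ → T3 → ℝ} {u : ℝ → T3 → V3}, IsHardSphereEulerSolution σ T ρ u θ → ∀ {t : ℝ}, t ∈ Set.Ico 0 T → (∀ s ∈ Set.Icc 0 t, ∀ x, ρ s x * σ ^ 3 < η₀) → ContinuousOn (fun r => ∫ x,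 eulerRate σ T ρ θ u r x) (Set.Icc 0 t) ∧ ∀ {a b : ℝ}, 0 ≤ a → a ≤ b → b ≤ t → (∫ x, ρ b x * (Real.log (ρ b x) + gChem σ (ρ b x) - 3 / 2 * Real.log (2 * Real.pi * θ b x) - 3 / 2)) - (∫ x, ρ a x * (Real.log (ρ a x) + gChem σ (ρ a x) - 3 / 2 * Real.log (2 * Real.pi * θ a x) - 3 / 2)) = ∫ r in a..b, ∫ x, eulerRate σ T ρ θ u r x := by
  intro η₀ F hη₀ hFa hEq σ T hσ ρ θ u hE t ht hband
  obtain ⟨T', htT', hT'T, hband'⟩ := exists_horizon_of_packing_lt hE hσ ht hband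
  have hE' : IsHardSphereEulerSolution σ T' ρ u θ := hE.restrict hT'T
  obtain ⟨hder, hcont⟩ := wa_hasDerivWithinAt_logProfileStatic hη₀ hFa hEq hσ hE' hband'
  have hIcc : Set.Icc 0 t ⊆ Set.Ico 0 T' := fun r hr => ⟨hr.1, hr.2.trans_lt htT'⟩
  have hrate : ∀ r ∈ Set.Ico 0 T', ∫ x, eulerRate σ T' ρ θ u r x = ∫ x, eulerRate σ T ρ θ u r x :=
    fun r hr => integral_congr_ae (Eventually.of_forall fun x => wa_eulerRate_restrict hT'T hr x)
  have hder' : ∀ r ∈ Set.Ico 0 T', HasDerivWithinAt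
      (fun s => ∫ x, ρ s x * (Real.log (ρ s x) + gChem σ (ρ s x) -
        3 / 2 * Real.log (2 * Real.pi * θ s x) - 3 / 2))
      (∫ x, eulerRate σ T ρ θ u r x) (Set.Ico 0 T') r := fun r hr =>
    (hder r hr).congr_deriv (hrate r hr)
  refine ⟨(hcont.mono hIcc).congr fun r hr => (hrate r (hIcc hr)).symm, ?_⟩
  intro a b ha hab hbt
  have hab' : Set.Icc a b ⊆ Set.Ico 0 T' := fun r hr =>
    ⟨le_trans ha hr.1, lt_of_le_of_lt (le_trans hr.2 hbt) htT'⟩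
  have hcm : ContinuousOn (fun s => ∫ x, ρ s x * (Real.log (ρ s x) + gChem σ (ρ s x) -
      3 / 2 * Real.log (2 * Real.pi * θ s x) - 3 / 2)) (Set.Icc a b) := fun r hr =>
    ((hder' r (hab' hr)).continuousWithinAt).mono hab'
  have hd : ∀ r ∈ Set.Ioo a b, HasDerivAt (fun s => ∫ x, ρ s x * (Real.log (ρ s x) + gChem σ (ρ s x) -
      3 / 2 * Real.log (2 * Real.pi * θ s x) - 3 / 2)) (∫ x, eulerRate σ T ρ θ u r x) r := fun r hr =>
    (hder' r (hab' (Set.Ioo_subset_Icc_self hr))).hasDerivAt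
      (mem_of_superset (Ioo_mem_nhds (lt_of_le_of_lt ha hr.1)
        (hab' (Set.Ioo_subset_Icc_self hr)).2) Set.Ioo_subset_Ico_self)
  have hint : IntervalIntegrable (fun r => ∫ x, eulerRate σ T ρ θ u r x) volume a b :=
    ((hcont.mono hab').congr fun r hr => (hrate r (hab' hr)).symm).intervalIntegrable_of_Icc hab
  exact (intervalIntegral.integral_eq_sub_of_hasDerivAt_of_le hab hcm hd hint).symm

end Summit.AtomisticToContinuum.HydrodynamicLimit.Theorems.NearConstantShortTimeHL
end
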